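import Literature.NumberTheory.LFunctions.YoshidaWindowGramEntryBox
import Literature.Analysis.ValidatedNumerics.IntervalGershgorin
import HarnessLib

/-!
# Kernel enclosures of Yoshida's matrix coefficients — IV: coupling columns and the dyadic column majorant

Source: H. Yoshida, Adv. Stud. Pure Math. **21** (1992) 281–325, §§5–7 [Yoshida1992HermitianForms]: beyond the
dense block `W` (modes `< B`) the format-C certificate controls the coupling columns `b_m = (M^σ(i,m))_{i<B}`,
`B ≤ m < B₃`, through a majorant `U₁ ⪰ Σ_m b_m b_mᵀ/d̂_m` (the Schur-complement step).  This file supplies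

* `Encl.checkCols` — the integer data `Dc` (unit `2^{−c}`, radius `ρ`) encloses the columns:
  `|M^σ(i, m) − Dc[m − m₀][i]·2^{−c}| ≤ ρ·2^{−c}` (`Encl.near_of_checkCols`);
* `Encl.checkMajorant` — given such column data, dyadic weights `v_t·2^{−cv} ≥ 1/d̂_{B+t}` and a claimed dyadic
  symmetric matrix `Uz` (unit `2^{−cU}`), an INTEGER Gershgorin test of
  `tθ·Uz·2^{2c+cv−cU} − (tθ+1)·T − tθ(tθ+1)ρ²B(Σv)·1`, `T_{ij} = Σ_t v_t Dc[t][i] Dc[t][j]`, whose success gives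
  exactly the hypothesis `hU₁` of `WeilFormatCSoundness.sum_range_mul_mul_nonneg_of_certificate_sum_split`:
  `Σ_{m ∈ Ico B B₃} (Σ_i M(i,m) x_i)²/d̂_m ≤ xᵀ U₁ x` with `U₁ = Uz·2^{−cU}` (`Encl.colMajorant_of_check`;
  Peter–Paul with `θ = 1/tθ`, Cauchy–Schwarz for the radius term, `IntervalGershgorin.form_nonneg_of_diagDominant`).
Everything is proved; no named facts.
-/

open Real Complex Finset Matrix
open scoped BigOperators

namespace Literature.NumberTheory.LFunctions.Yoshida1992

open Literature.Analysis.SpecialFunctions Literature.Analysis.ValidatedNumerics.NumericsMP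
open Literature.Analysis.ValidatedNumerics

namespace Encl

variable {S : ℕ} {a : ℝ} {ks : List PrimeLen} {C : Consts} {tab : List IdxRec}

/-! ## Column enclosures -/

/-- Check the columns `m₀ ≤ m < m₀ + k` (rows `i < B`) against the data `Dc` (row `m − m₀` of `Dc` = column `m`).
[cite: Moore1966, Ch. 3 (interval arithmetic: inclusion property)] -/
def checkCols (S c : ℕ) (ρ : ℤ) (C : Consts) (tab : List IdxRec) (odd : Bool) (B : ℕ) (Dc : List (List ℤ))
    (m0 k : ℕ) : Bool :=
  (List.range k).all fun t ↦ (List.range B).all fun i ↦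
    enclCheck S c ρ (PsdDyadic.getMZ Dc t i) (sectorBoxSym odd S C tab i (m0 + t))

/-- **Soundness of `checkCols`** (table valid below `m₀ + k + 1` and below `B + 1`).
[cite: Moore1966, Ch. 3 (interval arithmetic: inclusion property)] -/
theorem near_of_checkCols (hS : 0 < S) (ha0 : 0 < a) (hks : PrimeData a ks) (hC : ConstsValid S a ks C)
    {N : ℕ} (hT : TabValid S a ks N tab) {c : ℕ} {ρ : ℤ} {odd : Bool} {B : ℕ} {Dc : List (List ℤ)} {m0 k : ℕ}
    (h : checkCols S c ρ C tab odd B Dc m0 k = true) (hBN : B + 1 ≤ N) (hkN : m0 + k + 1 ≤ N)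
    {i t : ℕ} (hi : i < B) (ht : t < k) :
    |sectorKernel odd (gramCoeff a) i (m0 + t) - (PsdDyadic.getMZ Dc t i : ℝ) * (1 / 2 ^ c)| ≤ (ρ : ℝ) * (1 / 2 ^ c) := by
  unfold checkCols at h
  rw [List.all_eq_true] at h
  have h1 := h t (List.mem_range.mpr ht)
  rw [List.all_eq_true] at h1
  have h2 := h1 i (List.mem_range.mpr hi)
  exact abs_sub_le_of_enclCheck hS h2 (mem_sectorBoxSym hS ha0 hks hC hT odd (by omega) (by omega))

/-! ## The dyadic column majorant -/

/-- `T_{ij} = Σ_{t<K} v_t · Dc[t][i] · Dc[t][j]`. [cite: Moore1966, Ch. 3 (interval arithmetic: inclusion property)] -/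
def gramT (Dc : List (List ℤ)) (v : List ℤ) (K i j : ℕ) : ℤ :=
  (List.range K).foldr (fun t acc ↦ acc + v.getD t 0 * PsdDyadic.getMZ Dc t i * PsdDyadic.getMZ Dc t j) 0

/-- `Σ_{t<K} v_t`. [cite: Moore1966, Ch. 3 (interval arithmetic: inclusion property)] -/
def sumV (v : List ℤ) (K : ℕ) : ℤ := (List.range K).foldr (fun t acc ↦ acc + v.getD t 0) 0

/-- The scaled residual `Rz = tθ·2^{e}·Uz − (tθ+1)·T − [i=j]·tθ(tθ+1)ρ²B(Σv)`. [cite: Moore1966, Ch. 3 (interval arithmetic: inclusion property)] -/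
def resid (Dc : List (List ℤ)) (v : List ℤ) (K B : ℕ) (ρ : ℤ) (tθ e : ℕ) (Uz : List (List ℤ)) (i j : ℕ) : ℤ :=
  (tθ : ℤ) * 2 ^ e * PsdDyadic.getMZ Uz i j - ((tθ : ℤ) + 1) * gramT Dc v K i j -
    (if i = j then (tθ : ℤ) * ((tθ : ℤ) + 1) * ρ ^ 2 * (B : ℤ) * sumV v K else 0)

/-- Off-diagonal absolute row sum of the residual. [cite: Moore1966, Ch. 3 (interval arithmetic: inclusion property)] -/
def residOff (Dc : List (List ℤ)) (v : List ℤ) (K B : ℕ) (ρ : ℤ) (tθ e : ℕ) (Uz : List (List ℤ)) (i : ℕ) : ℤ :=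
  (List.range B).foldr (fun j acc ↦ acc + if j = i then 0 else |resid Dc v K B ρ tθ e Uz i j|) 0

/-- **The majorant check**: units compatible (`cU ≤ 2c + cv`), `tθ ≥ 1`, `ρ ≥ 0`, weights nonnegative and
dominating the reciprocals of the dyadic lower bounds `dlo_t·2^{−cd} ≤ d̂_{B+t}` (`v_t·dlo_t ≥ 2^{cv+cd}`), `Uz`
symmetric on `B × B`, and every row of the residual (`e = 2c + cv − cU`) diagonally dominant.
[cite: Moore1966, Ch. 3 (interval arithmetic: inclusion property)] -/
def checkMajorant (c cv cU cd tθ : ℕ) (ρ : ℤ) (B K : ℕ) (Dc : List (List ℤ)) (v dlo : List ℤ) (Uz : List (List ℤ)) :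
    Bool :=
  decide (cU ≤ 2 * c + cv) && decide (1 ≤ tθ) && decide (0 ≤ ρ) &&
    (List.range K).all (fun t ↦ decide (0 ≤ v.getD t 0) && decide (2 ^ (cv + cd) ≤ v.getD t 0 * dlo.getD t 0)) &&
    (List.range B).all (fun i ↦ (List.range B).all fun j ↦ decide (PsdDyadic.getMZ Uz i j = PsdDyadic.getMZ Uz j i)) &&
    (List.range B).all fun i ↦
      decide (residOff Dc v K B ρ tθ (2 * c + cv - cU) Uz i ≤ resid Dc v K B ρ tθ (2 * c + cv - cU) Uz i i)

/-! ### Real-side bookkeeping -/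

/-- `foldr` sums over `range` as `Finset` sums. [cite: Moore1966, Ch. 3 (interval arithmetic: inclusion property)] -/
theorem foldr_range_eq_sum (f : ℕ → ℤ) : ∀ K : ℕ,
    (List.range K).foldr (fun t acc ↦ acc + f t) 0 = ∑ t ∈ Finset.range K, f t := by
  have key : ∀ (l : List ℕ) (z : ℤ), l.foldr (fun t acc ↦ acc + f t) z = z + l.foldr (fun t acc ↦ acc + f t) 0 := by
    intro l; induction l with
    | nil => intro z; simp
    | cons y ys ihl => intro z; simp only [List.foldr_cons]; rw [ihl z]; ring
  intro K
  induction K with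
  | zero => simp
  | succ K ih => rw [List.range_succ, List.foldr_append, List.foldr_cons, List.foldr_nil, Finset.sum_range_succ, key, ih]; ring

/-- `gramT` as a sum. [cite: Moore1966, Ch. 3 (interval arithmetic: inclusion property)] -/
theorem gramT_eq (Dc : List (List ℤ)) (v : List ℤ) (K i j : ℕ) :
    gramT Dc v K i j = ∑ t ∈ Finset.range K, v.getD t 0 * PsdDyadic.getMZ Dc t i * PsdDyadic.getMZ Dc t j :=
  foldr_range_eq_sum _ K

/-- `sumV` as a sum. [cite: Moore1966, Ch. 3 (interval arithmetic: inclusion property)] -/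
theorem sumV_eq (v : List ℤ) (K : ℕ) : sumV v K = ∑ t ∈ Finset.range K, v.getD t 0 := foldr_range_eq_sum _ K

/-- `residOff` as a sum. [cite: Moore1966, Ch. 3 (interval arithmetic: inclusion property)] -/
theorem residOff_eq (Dc : List (List ℤ)) (v : List ℤ) (K B : ℕ) (ρ : ℤ) (tθ e : ℕ) (Uz : List (List ℤ)) (i : ℕ) :
    residOff Dc v K B ρ tθ e Uz i = ∑ j ∈ Finset.range B, (if j = i then 0 else |resid Dc v K B ρ tθ e Uz i j|) :=
  foldr_range_eq_sum _ B

/-- `gramT` is symmetric. [cite: Moore1966, Ch. 3 (interval arithmetic: inclusion property)] -/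
theorem gramT_comm (Dc : List (List ℤ)) (v : List ℤ) (K i j : ℕ) : gramT Dc v K i j = gramT Dc v K j i := by
  rw [gramT_eq, gramT_eq]; exact Finset.sum_congr rfl fun t _ ↦ by ring

/-- Peter–Paul: `(p+q)² ≤ (1 + 1/t)p² + (1 + t)q²` for `t > 0`. [cite: Moore1966, Ch. 3 (interval arithmetic: inclusion property)] -/
theorem sq_add_le_pp {t : ℝ} (ht : 0 < t) (p q : ℝ) : (p + q) ^ 2 ≤ (1 + 1 / t) * p ^ 2 + (1 + t) * q ^ 2 := by
  have h : 0 ≤ (p - t * q) ^ 2 / t := div_nonneg (sq_nonneg _) ht.le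
  have e : (1 + 1 / t) * p ^ 2 + (1 + t) * q ^ 2 - (p + q) ^ 2 = (p - t * q) ^ 2 / t := by
    field_simp; ring
  linarith

/-- Cauchy–Schwarz for the radius term: `(Σ_i e_i x_i)² ≤ r²·B·Σ x_i²` when `|e_i| ≤ r`.
[cite: Moore1966, Ch. 3 (interval arithmetic: inclusion property)] -/
theorem sq_sum_le_of_abs_le {B : ℕ} {e x : Fin B → ℝ} {r : ℝ} (he : ∀ i, |e i| ≤ r) :
    (∑ i, e i * x i) ^ 2 ≤ r ^ 2 * B * ∑ i, x i ^ 2 := by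
  have h1 : (∑ i, e i * x i) ^ 2 ≤ (∑ i, e i ^ 2) * ∑ i, x i ^ 2 := Finset.sum_mul_sq_le_sq_mul_sq _ _ _
  have h2 : ∑ i : Fin B, e i ^ 2 ≤ r ^ 2 * B := by
    calc ∑ i : Fin B, e i ^ 2 ≤ ∑ _i : Fin B, r ^ 2 := Finset.sum_le_sum fun i _ ↦ by
            have := he i; rw [abs_le] at this; nlinarith
      _ = r ^ 2 * B := by simp [mul_comm]
  have h3 : 0 ≤ ∑ i : Fin B, x i ^ 2 := Finset.sum_nonneg fun i _ ↦ sq_nonneg _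
  nlinarith

/-- **The dyadic column majorant.**  Let `M` be any real kernel whose columns `m = B + t`, `t < K`, are enclosed
by the data: `|M(i, B+t) − Dc[t][i]·2^{−c}| ≤ ρ·2^{−c}`, let `d̂(B+t) ≥ dlo_t·2^{−cd}` with `dlo_t > 0`, and let
`checkMajorant c cv cU cd tθ ρ B K Dc v dlo Uz = true`.  Then for every `x`,
`Σ_{m ∈ Ico B (B+K)} (Σ_i M(i,m) x_i)²/d̂_m ≤ xᵀ U₁ x` with `U₁(i,j) = Uz[i][j]·2^{−cU}` — the hypothesis `hU₁`
of `WeilFormatCSoundness.sum_range_mul_mul_nonneg_of_certificate_sum_split`.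
[cite: Yoshida1992HermitianForms, §7 pp. 305–312 (the finite certificate)] -/
theorem colMajorant_of_check {M : ℕ → ℕ → ℝ} {dhat : ℕ → ℝ} {B K c cv cU cd tθ : ℕ} {ρ : ℤ}
    {Dc : List (List ℤ)} {v dlo : List ℤ} {Uz : List (List ℤ)}
    (hcol : ∀ i < B, ∀ t < K, |M i (B + t) - (PsdDyadic.getMZ Dc t i : ℝ) * (1 / 2 ^ c)| ≤ (ρ : ℝ) * (1 / 2 ^ c))
    (hdlo : ∀ t < K, 0 < dlo.getD t 0 ∧ (dlo.getD t 0 : ℝ) * (1 / 2 ^ cd) ≤ dhat (B + t))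
    (h : checkMajorant c cv cU cd tθ ρ B K Dc v dlo Uz = true) (x : Fin B → ℝ) :
    ∑ m ∈ Finset.Ico B (B + K), (∑ i : Fin B, M i m * x i) ^ 2 / dhat m
      ≤ x ⬝ᵥ (Matrix.of fun i j : Fin B ↦ (PsdDyadic.getMZ Uz i j : ℝ) * (1 / 2 ^ cU)) *ᵥ x := by
  simp only [checkMajorant, Bool.and_eq_true, decide_eq_true_eq, List.all_eq_true, List.mem_range] at h
  obtain ⟨⟨⟨⟨⟨hcU, htθ⟩, hρ⟩, hv'⟩, hsym⟩, hdom⟩ := h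
  have hv : ∀ t < K, 0 ≤ v.getD t 0 := fun t ht ↦ (hv' t ht).1
  have hd : ∀ t < K, 0 < dhat (B + t) ∧ 1 / dhat (B + t) ≤ (v.getD t 0 : ℝ) * (1 / 2 ^ cv) := by
    intro t ht
    obtain ⟨hd0, hdle⟩ := hdlo t ht
    have hvd : (2 : ℝ) ^ (cv + cd) ≤ (v.getD t 0 : ℝ) * (dlo.getD t 0 : ℝ) := by exact_mod_cast (hv' t ht).2
    have hd0r : (0 : ℝ) < dlo.getD t 0 := by exact_mod_cast hd0
    have hlo : 0 < (dlo.getD t 0 : ℝ) * (1 / 2 ^ cd) := by positivity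
    have hpos : 0 < dhat (B + t) := lt_of_lt_of_le hlo hdle
    refine ⟨hpos, ?_⟩
    calc 1 / dhat (B + t) ≤ 1 / ((dlo.getD t 0 : ℝ) * (1 / 2 ^ cd)) := one_div_le_one_div_of_le hlo hdle
      _ ≤ (v.getD t 0 : ℝ) * (1 / 2 ^ cv) := by
          rw [div_le_iff₀ hlo, pow_add] at *
          have h2 : (0 : ℝ) < 2 ^ cv := by positivity
          have h3 : (0 : ℝ) < 2 ^ cd := by positivity
          field_simp
          exact hvd
  -- abbreviations
  set u : ℝ := 1 / 2 ^ c with hu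
  set uv : ℝ := 1 / 2 ^ cv with huv
  set uU : ℝ := 1 / 2 ^ cU with huU
  set θ : ℝ := (tθ : ℝ) with hθ
  have hθpos : 0 < θ := by rw [hθ]; exact_mod_cast htθ
  have hu0 : 0 < u := by rw [hu]; positivity
  have hρr : (0 : ℝ) ≤ ρ := by exact_mod_cast hρ
  set β : ℕ → Fin B → ℝ := fun t i ↦ (PsdDyadic.getMZ Dc t i : ℝ) with hβ
  set w : ℕ → ℝ := fun t ↦ (v.getD t 0 : ℝ) with hw
  have hw0 : ∀ t < K, 0 ≤ w t := fun t ht ↦ by simp only [hw]; exact_mod_cast hv t ht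
  set X2 : ℝ := ∑ i : Fin B, x i ^ 2 with hX2
  have hX2nn : 0 ≤ X2 := Finset.sum_nonneg fun i _ ↦ sq_nonneg _
  clear_value X2
  -- Step 1: per column
  have hstep : ∀ t < K, (∑ i : Fin B, M i (B + t) * x i) ^ 2 / dhat (B + t)
      ≤ w t * uv * ((1 + 1 / θ) * (u ^ 2 * (∑ i : Fin B, β t i * x i) ^ 2) + (1 + θ) * ((ρ * u) ^ 2 * B * X2)) := by
    intro t ht
    obtain ⟨hdpos, hdle⟩ := hd t ht
    set s := ∑ i : Fin B, M i (B + t) * x i with hs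
    set p := u * ∑ i : Fin B, β t i * x i with hp
    have hq : (s - p) ^ 2 ≤ (ρ * u) ^ 2 * B * X2 := by
      have e : s - p = ∑ i : Fin B, (M i (B + t) - β t i * u) * x i := by
        rw [hs, hp, Finset.mul_sum, ← Finset.sum_sub_distrib]
        exact Finset.sum_congr rfl fun i _ ↦ by ring
      rw [e, hX2]
      exact sq_sum_le_of_abs_le fun i ↦ hcol i i.isLt t ht
    have h1 : s ^ 2 / dhat (B + t) ≤ s ^ 2 * (w t * uv) := by
      rw [div_eq_mul_one_div]
      exact mul_le_mul_of_nonneg_left hdle (sq_nonneg _)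
    have h2 : s ^ 2 ≤ (1 + 1 / θ) * p ^ 2 + (1 + θ) * (s - p) ^ 2 := by
      have := sq_add_le_pp hθpos p (s - p); rwa [add_sub_cancel] at this
    have h3 : s ^ 2 ≤ (1 + 1 / θ) * p ^ 2 + (1 + θ) * ((ρ * u) ^ 2 * B * X2) := by
      have : (1 + θ) * (s - p) ^ 2 ≤ (1 + θ) * ((ρ * u) ^ 2 * B * X2) :=
        mul_le_mul_of_nonneg_left hq (by linarith)
      linarith
    have hwuv : 0 ≤ w t * uv := mul_nonneg (hw0 t ht) (by rw [huv]; positivity)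
    calc s ^ 2 / dhat (B + t) ≤ s ^ 2 * (w t * uv) := h1
      _ ≤ ((1 + 1 / θ) * p ^ 2 + (1 + θ) * ((ρ * u) ^ 2 * B * X2)) * (w t * uv) :=
          mul_le_mul_of_nonneg_right h3 hwuv
      _ = _ := by ring
  -- Step 2: sum over the columns
  rw [Finset.sum_Ico_eq_sum_range, show B + K - B = K by omega]
  have hsum : ∑ t ∈ Finset.range K, (∑ i : Fin B, M i (B + t) * x i) ^ 2 / dhat (B + t)
      ≤ (1 + 1 / θ) * uv * u ^ 2 * ∑ t ∈ Finset.range K, w t * (∑ i : Fin B, β t i * x i) ^ 2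
        + (1 + θ) * uv * (ρ * u) ^ 2 * B * (∑ t ∈ Finset.range K, w t) * X2 := by
    refine (Finset.sum_le_sum fun t ht ↦ hstep t (Finset.mem_range.mp ht)).trans (le_of_eq ?_)
    simp only [Finset.mul_sum, Finset.sum_mul, ← Finset.sum_add_distrib]
    exact Finset.sum_congr rfl fun t _ ↦ by ring
  refine hsum.trans ?_
  -- the quadratic form Σ_t w_t (β_t·x)² = Σ_i Σ_j x_i x_j T_ij
  have hT : ∑ t ∈ Finset.range K, w t * (∑ i : Fin B, β t i * x i) ^ 2
      = ∑ i : Fin B, ∑ j : Fin B, (gramT Dc v K i j : ℝ) * (x i * x j) := by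
    have e1 : ∀ t, w t * (∑ i : Fin B, β t i * x i) ^ 2 = ∑ i : Fin B, ∑ j : Fin B, w t * β t i * β t j * (x i * x j) := by
      intro t
      rw [sq, Finset.sum_mul_sum, Finset.mul_sum]
      refine Finset.sum_congr rfl fun i _ ↦ ?_
      rw [Finset.mul_sum]
      exact Finset.sum_congr rfl fun j _ ↦ by ring
    simp_rw [e1]
    rw [Finset.sum_comm]
    refine Finset.sum_congr rfl fun i _ ↦ ?_
    rw [Finset.sum_comm]
    refine Finset.sum_congr rfl fun j _ ↦ ?_
    rw [gramT_eq]; push_cast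
    rw [Finset.sum_mul]
  rw [hT]
  -- Step 3: Gershgorin on the residual
  set e := 2 * c + cv - cU with he
  set A : Matrix (Fin B) (Fin B) ℝ := Matrix.of fun i j : Fin B ↦ (resid Dc v K B ρ tθ e Uz i j : ℝ) with hA
  have hAsymm : Aᵀ = A := by
    ext i j
    simp only [hA, Matrix.transpose_apply, Matrix.of_apply, resid]
    rw [hsym i i.isLt j j.isLt, gramT_comm]
    by_cases hij : (i : ℕ) = j
    · rw [if_pos hij, if_pos hij.symm]
    · rw [if_neg hij, if_neg (Ne.symm hij)]
  have hAdom : ∀ i : Fin B, IntervalGershgorin.offRowSum A i ≤ A i i := by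
    intro i
    have h1 := hdom i i.isLt
    rw [residOff_eq] at h1
    have h2 : IntervalGershgorin.offRowSum A i
        = ((∑ j ∈ Finset.range B, (if j = (i : ℕ) then 0 else |resid Dc v K B ρ tθ e Uz i j|) : ℤ) : ℝ) := by
      unfold IntervalGershgorin.offRowSum
      push_cast
      rw [← Fin.sum_univ_eq_sum_range (fun j ↦ if j = (i : ℕ) then (0 : ℝ) else |(resid Dc v K B ρ tθ e Uz i j : ℝ)|)]
      refine Finset.sum_congr rfl fun j _ ↦ ?_
      simp only [hA, Matrix.of_apply]
      by_cases hji : j = i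
      · subst hji; simp
      · rw [if_neg hji, if_neg (fun h' ↦ hji (Fin.ext h'))]
    rw [h2]
    simp only [hA, Matrix.of_apply]
    exact_mod_cast h1
  have hform := IntervalGershgorin.form_nonneg_of_diagDominant hAsymm hAdom x
  rw [IntervalGershgorin.form_eq_sum_sum] at hform
  -- unfold the residual inside the form
  have hexp : ∑ i : Fin B, ∑ j : Fin B, A i j * (x i * x j)
      = θ * 2 ^ e * ∑ i : Fin B, ∑ j : Fin B, (PsdDyadic.getMZ Uz i j : ℝ) * (x i * x j)
        - (θ + 1) * ∑ i : Fin B, ∑ j : Fin B, (gramT Dc v K i j : ℝ) * (x i * x j)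
        - θ * (θ + 1) * ρ ^ 2 * B * (sumV v K : ℝ) * X2 := by
    simp only [hA, Matrix.of_apply, resid]
    push_cast
    have e3 : ∀ i : Fin B, ∑ j : Fin B, (if (i : ℕ) = (j : ℕ) then θ * (θ + 1) * (ρ : ℝ) ^ 2 * (B : ℝ) * (sumV v K : ℝ) else 0) * (x i * x j)
        = θ * (θ + 1) * ρ ^ 2 * B * (sumV v K : ℝ) * x i ^ 2 := by
      intro i
      rw [Finset.sum_eq_single i]
      · simp [sq]
      · intro j _ hji; rw [if_neg (fun h' ↦ hji (Fin.ext h'.symm))]; ring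
      · simp
    rw [hX2, Finset.mul_sum, Finset.mul_sum, Finset.mul_sum, ← Finset.sum_sub_distrib, ← Finset.sum_sub_distrib]
    refine Finset.sum_congr rfl fun i _ ↦ ?_
    rw [← e3 i, Finset.mul_sum, Finset.mul_sum, ← Finset.sum_sub_distrib, ← Finset.sum_sub_distrib]
    refine Finset.sum_congr rfl fun j _ ↦ ?_
    split_ifs <;> ring
  rw [hexp, sumV_eq] at hform
  push_cast at hform
  -- the target form
  rw [IntervalGershgorin.form_eq_sum_sum]
  simp only [Matrix.of_apply]
  -- scale: multiply the Gershgorin inequality by uU/(θ) ... equivalently compare after clearing 2-powers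
  have h2e : (2 : ℝ) ^ e * (u ^ 2 * uv) = uU := by
    have hpow : (2 : ℝ) ^ e * 2 ^ cU = (2 ^ c) ^ 2 * 2 ^ cv := by
      rw [← pow_mul, ← pow_add, ← pow_add]; congr 1; omega
    rw [hu, huv, huU]
    field_simp
    linear_combination hpow
  have hwsum : ∑ t ∈ Finset.range K, w t = ∑ t ∈ Finset.range K, (v.getD t 0 : ℝ) := rfl
  -- Let Q := Σ Uz x x, TT := Σ T x x.
  set Q := ∑ i : Fin B, ∑ j : Fin B, (PsdDyadic.getMZ Uz i j : ℝ) * (x i * x j) with hQ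
  set TT := ∑ i : Fin B, ∑ j : Fin B, (gramT Dc v K i j : ℝ) * (x i * x j) with hTT
  have goal_eq : ∑ i : Fin B, ∑ j : Fin B, (PsdDyadic.getMZ Uz i j : ℝ) * uU * (x i * x j) = uU * Q := by
    rw [hQ, Finset.mul_sum]; refine Finset.sum_congr rfl fun i _ ↦ ?_
    rw [Finset.mul_sum]; exact Finset.sum_congr rfl fun j _ ↦ by ring
  rw [goal_eq]
  -- from hform: θ 2^e Q − (θ+1) TT − θ(θ+1)ρ²B(Σv) X2 ≥ 0; multiply by (u² uv)/θ > 0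
  have hfac : 0 < u ^ 2 * uv / θ := div_pos (by rw [huv]; positivity) hθpos
  have key := mul_nonneg hfac.le hform
  have e4 : u ^ 2 * uv / θ * (θ * 2 ^ e * Q - (θ + 1) * TT -
        θ * (θ + 1) * (ρ : ℝ) ^ 2 * B * (∑ t ∈ Finset.range K, (v.getD t 0 : ℝ)) * X2)
      = uU * Q - (1 + 1 / θ) * (u ^ 2 * uv) * TT
        - (1 + θ) * (u ^ 2 * uv) * ρ ^ 2 * B * (∑ t ∈ Finset.range K, (v.getD t 0 : ℝ)) * X2 := by
    rw [← h2e]; field_simp; ring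
  rw [e4] at key
  rw [hwsum]
  nlinarith [key]

/-! ## The Schur-complement enclosure with TRUE-column `U₁` (weil-10's design, FORMATC-DESIGN §9)

`U₁ := Σ_{m ∈ Ico B (B+K)} b_m b_mᵀ/d_m` with the true columns `b_m(i) = M(i,m)` and positive dyadic lower bounds
`d_m = dz_{m−B}·2^{−cd} ≤ d̂_m`; then `hU₁` is one line, and the (P) object is the kernel enclosure of
`S(i,j) = M(i,j) − U₁(i,j) − U₂(i,j)` from the entry boxes, the CERTIFIED column data and enclosed `U₂` data. -/

/-- `U₁(i,j) = Σ_{t<K} M(i,B+t)·M(j,B+t)/d_t`, `d_t = dz_t·2^{−cd}`. [cite: Yoshida1992HermitianForms, §7 pp. 305–312 (the finite certificate)] -/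
noncomputable def U1 (M : ℕ → ℕ → ℝ) (B K cd : ℕ) (dz : List ℤ) : Matrix (Fin B) (Fin B) ℝ :=
  Matrix.of fun i j ↦ ∑ t ∈ Finset.range K, M i (B + t) * M j (B + t) / ((dz.getD t 0 : ℝ) * (1 / 2 ^ cd))

/-- **`hU₁` for the true-column majorant**: if `0 < dz_t·2^{−cd} ≤ d̂(B+t)` then
`Σ_{m∈Ico B (B+K)} (Σ_i M(i,m)x_i)²/d̂_m ≤ xᵀ U₁ x`. [cite: Yoshida1992HermitianForms, §7 pp. 305–312 (the finite certificate)] -/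
theorem hU1_of_le {M : ℕ → ℕ → ℝ} {dhat : ℕ → ℝ} {B K cd : ℕ} {dz : List ℤ}
    (hd : ∀ t < K, 0 < dz.getD t 0 ∧ (dz.getD t 0 : ℝ) * (1 / 2 ^ cd) ≤ dhat (B + t)) (x : Fin B → ℝ) :
    ∑ m ∈ Finset.Ico B (B + K), (∑ i : Fin B, M i m * x i) ^ 2 / dhat m ≤ x ⬝ᵥ U1 M B K cd dz *ᵥ x := by
  rw [Finset.sum_Ico_eq_sum_range, show B + K - B = K by omega, IntervalGershgorin.form_eq_sum_sum]
  have e1 : ∀ t, (∑ i : Fin B, M i (B + t) * x i) ^ 2 / ((dz.getD t 0 : ℝ) * (1 / 2 ^ cd))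
      = ∑ i : Fin B, ∑ j : Fin B, M i (B + t) * M j (B + t) / ((dz.getD t 0 : ℝ) * (1 / 2 ^ cd)) * (x i * x j) := by
    intro t
    rw [sq, Finset.sum_mul_sum, Finset.sum_div]
    refine Finset.sum_congr rfl fun i _ ↦ ?_
    rw [Finset.sum_div]
    exact Finset.sum_congr rfl fun j _ ↦ by ring
  have e : ∑ i : Fin B, ∑ j : Fin B, U1 M B K cd dz i j * (x i * x j)
      = ∑ t ∈ Finset.range K, (∑ i : Fin B, M i (B + t) * x i) ^ 2 / ((dz.getD t 0 : ℝ) * (1 / 2 ^ cd)) := by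
    calc ∑ i : Fin B, ∑ j : Fin B, U1 M B K cd dz i j * (x i * x j)
        = ∑ i : Fin B, ∑ j : Fin B, ∑ t ∈ Finset.range K,
            M i (B + t) * M j (B + t) / ((dz.getD t 0 : ℝ) * (1 / 2 ^ cd)) * (x i * x j) := by
          simp only [U1, Matrix.of_apply, Finset.sum_mul]
      _ = ∑ i : Fin B, ∑ t ∈ Finset.range K, ∑ j : Fin B,
            M i (B + t) * M j (B + t) / ((dz.getD t 0 : ℝ) * (1 / 2 ^ cd)) * (x i * x j) :=
          Finset.sum_congr rfl fun i _ ↦ Finset.sum_comm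
      _ = ∑ t ∈ Finset.range K, ∑ i : Fin B, ∑ j : Fin B,
            M i (B + t) * M j (B + t) / ((dz.getD t 0 : ℝ) * (1 / 2 ^ cd)) * (x i * x j) := Finset.sum_comm
      _ = _ := Finset.sum_congr rfl fun t _ ↦ (e1 t).symm
  rw [e]
  refine Finset.sum_le_sum fun t ht ↦ ?_
  obtain ⟨hz, hle⟩ := hd t (Finset.mem_range.mp ht)
  have hlo : 0 < (dz.getD t 0 : ℝ) * (1 / 2 ^ cd) := by
    have : (0 : ℝ) < dz.getD t 0 := by exact_mod_cast hz
    positivity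
  exact div_le_div_of_nonneg_left (sq_nonneg _) hlo hle

/-- The interval of a certified datum: `|v − d·2^{−c}| ≤ ρ·2^{−c}` ⇒ `v ∈ colBox S c d ρ`.
[cite: Moore1966, Ch. 3 (interval arithmetic: inclusion property)] -/
def colBox (S c : ℕ) (d ρ : ℤ) : MI := MI.span (MI.ofFrac S (d - ρ) (2 ^ c)) (MI.ofFrac S (d + ρ) (2 ^ c))

/-- [cite: Moore1966, Ch. 3 (interval arithmetic: inclusion property)] -/
theorem mem_colBox {c : ℕ} {d ρ : ℤ} {v : ℝ} (h : |v - (d : ℝ) * (1 / 2 ^ c)| ≤ (ρ : ℝ) * (1 / 2 ^ c)) :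
    MI.mem S v (colBox S c d ρ) := by
  have h2 : (0 : ℝ) < 2 ^ c := by positivity
  rw [abs_le] at h
  refine MI.mem_span (MI.mem_ofFrac S (d - ρ) (q := 2 ^ c) (by positivity))
    (MI.mem_ofFrac S (d + ρ) (q := 2 ^ c) (by positivity)) ?_ ?_
  · push_cast
    rw [div_le_iff₀ h2]
    have := h.1
    have e : (d : ℝ) * (1 / 2 ^ c) * 2 ^ c = d := by field_simp
    have e' : (ρ : ℝ) * (1 / 2 ^ c) * 2 ^ c = ρ := by field_simp
    nlinarith [mul_le_mul_of_nonneg_right this h2.le]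
  · push_cast
    rw [le_div_iff₀ h2]
    have := h.2
    nlinarith [mul_le_mul_of_nonneg_right this h2.le, show (d : ℝ) * (1 / 2 ^ c) * 2 ^ c = d by field_simp,
      show (ρ : ℝ) * (1 / 2 ^ c) * 2 ^ c = ρ by field_simp]

/-- `Σ_{t<K} [col i]_t · [col j]_t · 2^{cd}/dz_t` from the certified column data.
[cite: Moore1966, Ch. 3 (interval arithmetic: inclusion property)] -/
def colSumBox (S c : ℕ) (Dc : List (List ℤ)) (ρc : ℤ) (cd : ℕ) (dz : List ℤ) (i j : ℕ) : ℕ → MI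
  | 0 => MI.ofInt S 0
  | t + 1 => (colSumBox S c Dc ρc cd dz i j t).add
      ((((colBox S c (PsdDyadic.getMZ Dc t i) ρc).mul S (colBox S c (PsdDyadic.getMZ Dc t j) ρc)).mulInt (2 ^ cd)).divNat
        (dz.getD t 0).toNat)

/-- [cite: Moore1966, Ch. 3 (interval arithmetic: inclusion property)] -/
theorem mem_colSumBox (hS : 0 < S) {M : ℕ → ℕ → ℝ} {B c cd : ℕ} {Dc : List (List ℤ)} {ρc : ℤ} {dz : List ℤ}
    {i j : ℕ} {K : ℕ}
    (hcol : ∀ t < K, |M i (B + t) - (PsdDyadic.getMZ Dc t i : ℝ) * (1 / 2 ^ c)| ≤ (ρc : ℝ) * (1 / 2 ^ c) ∧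
      |M j (B + t) - (PsdDyadic.getMZ Dc t j : ℝ) * (1 / 2 ^ c)| ≤ (ρc : ℝ) * (1 / 2 ^ c))
    (hz : ∀ t < K, 0 < dz.getD t 0) :
    ∀ k ≤ K, MI.mem S (∑ t ∈ Finset.range k, M i (B + t) * M j (B + t) / ((dz.getD t 0 : ℝ) * (1 / 2 ^ cd)))
      (colSumBox S c Dc ρc cd dz i j k)
  | 0, _ => by simpa [colSumBox] using MI.mem_ofInt S 0
  | k + 1, hk => by
      rw [Finset.sum_range_succ, colSumBox]
      have hk' : k < K := hk
      obtain ⟨hi, hj⟩ := hcol k hk'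
      have hzk := hz k hk'
      have hzn : 0 < (dz.getD k 0).toNat := by omega
      have h := MI.mem_divNat (MI.mem_mulInt (MI.mem_mul hS (mem_colBox hi) (mem_colBox hj)) (2 ^ cd)) hzn
      refine MI.mem_add (mem_colSumBox hS hcol hz k (by omega)) (mem_of_eq h ?_)
      have ez : (((dz.getD k 0).toNat : ℕ) : ℝ) = (dz.getD k 0 : ℝ) := by
        have : ((dz.getD k 0).toNat : ℤ) = dz.getD k 0 := Int.toNat_of_nonneg hzk.le
        exact_mod_cast this
      rw [ez]
      have hzr : (0 : ℝ) < dz.getD k 0 := by exact_mod_cast hzk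
      push_cast
      field_simp

/-- **The Schur-complement entry box** `S(i,j) = M(i,j) − Σ_t M(i,B+t)M(j,B+t)/d_t − U₂(i,j)` from the entry box,
the certified column data and the enclosed `U₂` datum. [cite: Yoshida1992HermitianForms, §7 pp. 305–312 (the finite certificate)] -/
def schurBox (odd : Bool) (S : ℕ) (C : Consts) (tab : List IdxRec) (c : ℕ) (Dc : List (List ℤ)) (ρc : ℤ) (cd : ℕ)
    (dz : List ℤ) (K c₂ : ℕ) (U2z : List (List ℤ)) (ρ₂ : ℤ) (i j : ℕ) : MI :=
  (sectorBoxSym odd S C tab i j).sub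
    ((colSumBox S c Dc ρc cd dz i j K).add (colBox S c₂ (PsdDyadic.getMZ U2z i j) ρ₂))

/-- Check a band of rows of the Schur-complement matrix against the data `DS` (unit `2^{−c}`, radius `ρS`);
includes the positivity of the `dz`. [cite: Moore1966, Ch. 3 (interval arithmetic: inclusion property)] -/
def checkSchurRows (S c : ℕ) (ρS : ℤ) (C : Consts) (tab : List IdxRec) (odd : Bool) (B : ℕ) (Dc : List (List ℤ))
    (ρc : ℤ) (cd : ℕ) (dz : List ℤ) (K c₂ : ℕ) (U2z : List (List ℤ)) (ρ₂ : ℤ) (DS : List (List ℤ)) (i0 k : ℕ) : Bool :=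
  (List.range K).all (fun t ↦ decide (0 < dz.getD t 0)) &&
    (List.range k).all fun di ↦ (List.range B).all fun j ↦
      enclCheck S c ρS (PsdDyadic.getMZ DS (i0 + di) j) (schurBox odd S C tab c Dc ρc cd dz K c₂ U2z ρ₂ (i0 + di) j)

/-- The real Schur-complement matrix on `ℕ × ℕ`. [cite: Yoshida1992HermitianForms, §7 pp. 305–312 (the finite certificate)] -/
noncomputable def schurEntry (M : ℕ → ℕ → ℝ) (B K cd : ℕ) (dz : List ℤ) (U₂ : ℕ → ℕ → ℝ) (i j : ℕ) : ℝ :=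
  M i j - (∑ t ∈ Finset.range K, M i (B + t) * M j (B + t) / ((dz.getD t 0 : ℝ) * (1 / 2 ^ cd))) - U₂ i j

/-- **Soundness of `checkSchurRows`**: on the band, `DS` encloses the Schur-complement matrix of the sector kernel
of `gramCoeff a` within `ρS·2^{−c}`, given the certified column data (`col_near`) and the `U₂` data.
[cite: Yoshida1992HermitianForms, §7 pp. 305–312 (the finite certificate)] -/
theorem near_schur_of_check (hS : 0 < S) (ha0 : 0 < a) (hks : PrimeData a ks) (hC : ConstsValid S a ks C)
    {N : ℕ} (hT : TabValid S a ks N tab) {odd : Bool} {B K c cd c₂ : ℕ} {ρS ρc ρ₂ : ℤ}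
    {Dc U2z DS : List (List ℤ)} {dz : List ℤ} {U₂ : ℕ → ℕ → ℝ} {i0 k : ℕ} (hBN : B + 1 ≤ N)
    (hcol : ∀ i < B, ∀ t < K, |sectorKernel odd (gramCoeff a) i (B + t) - (PsdDyadic.getMZ Dc t i : ℝ) * (1 / 2 ^ c)|
      ≤ (ρc : ℝ) * (1 / 2 ^ c))
    (hU2 : ∀ i < B, ∀ j < B, |U₂ i j - (PsdDyadic.getMZ U2z i j : ℝ) * (1 / 2 ^ c₂)| ≤ (ρ₂ : ℝ) * (1 / 2 ^ c₂))
    (h : checkSchurRows S c ρS C tab odd B Dc ρc cd dz K c₂ U2z ρ₂ DS i0 k = true)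
    {i j : ℕ} (hi : i0 ≤ i) (hik : i < i0 + k) (hiB : i < B) (hj : j < B) :
    |schurEntry (sectorKernel odd (gramCoeff a)) B K cd dz U₂ i j - (PsdDyadic.getMZ DS i j : ℝ) * (1 / 2 ^ c)|
      ≤ (ρS : ℝ) * (1 / 2 ^ c) := by
  simp only [checkSchurRows, Bool.and_eq_true, List.all_eq_true, List.mem_range, decide_eq_true_eq] at h
  obtain ⟨hz, hrows⟩ := h
  have h2 := hrows (i - i0) (by omega) j hj
  rw [show i0 + (i - i0) = i by omega] at h2
  refine abs_sub_le_of_enclCheck hS h2 ?_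
  unfold schurEntry schurBox
  have hM := mem_sectorBoxSym hS ha0 hks hC hT odd (i := i) (j := j) (by omega) (by omega)
  have hU1 := mem_colSumBox hS (cd := cd) (fun t ht ↦ ⟨hcol i hiB t ht, hcol j hj t ht⟩) hz K le_rfl
  have hU2' : MI.mem S (U₂ i j) (colBox S c₂ (PsdDyadic.getMZ U2z i j) ρ₂) := mem_colBox (hU2 i hiB j hj)
  exact mem_of_eq (MI.mem_sub hM (MI.mem_add hU1 hU2')) (by ring)

/-- Packaging for `sum_range_mul_mul_nonneg_of_certificate_sum_split`: the matrix fed to `PsdDyadic.psd_of_checkPsdMid`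
is `fun i j : Fin B ↦ M i j − U1 … i j − U₂ i j = schurEntry …`. [cite: Yoshida1992HermitianForms, §7 pp. 305–312 (the finite certificate)] -/
theorem schurEntry_eq (M : ℕ → ℕ → ℝ) (B K cd : ℕ) (dz : List ℤ) (U₂ : ℕ → ℕ → ℝ) (i j : Fin B) :
    M i j - U1 M B K cd dz i j - U₂ i j = schurEntry M B K cd dz U₂ i j := by
  simp [U1, schurEntry, Matrix.of_apply]

/-! ## List-form kernels (semilocal instances: `gramCoeffList a ks` for an arbitrary prime list, no `PrimeData`)

The `S = {∞} ∪ S₀` forms (cc-s2-4's `S2FormatC.gram`, `S₀ = {2}`) have the coefficients `gramCoeffList b ks` with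
`ks` the prime powers of `S₀` in the window; the same boxes enclose them, only the identification with `gramCoeff`
(which needs `PrimeData`) is dropped. -/

/-- The list-form coefficient is symmetric. [cite: Yoshida1992HermitianForms, §5 (5.15)-(5.16) p. 301] -/
theorem gramCoeffList_comm (a : ℝ) (ks : List PrimeLen) (n m : ℤ) :
    gramCoeffList a ks n m = gramCoeffList a ks m n := by
  unfold gramCoeffList
  rw [polarCoeff_comm, archCoeff_comm]
  congr 2
  refine congrArg List.sum (List.map_congr_left fun q _ ↦ ?_)
  rw [incrCoeff_comm]
  by_cases h : n = m
  · subst h; rfl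
  · rw [if_neg h, if_neg (Ne.symm h)]

/-- The list-form coefficient is reflection-invariant. [cite: Yoshida1992HermitianForms, §6 (6.10) p. 303] -/
theorem gramCoeffList_neg_neg (a : ℝ) (ks : List PrimeLen) (n m : ℤ) :
    gramCoeffList a ks (-n) (-m) = gramCoeffList a ks n m := by
  unfold gramCoeffList
  rw [polarCoeff_neg_neg, archCoeff_neg_neg]
  congr 2
  refine congrArg List.sum (List.map_congr_left fun q _ ↦ ?_)
  rw [incrCoeff_neg_neg]
  by_cases h : n = m
  · subst h; simp
  · rw [if_neg (fun h' ↦ h (neg_inj.1 h')), if_neg h]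

/-- The sector kernels of `gramCoeffList a ks` are symmetric. [cite: Yoshida1992HermitianForms, §6 (6.10) p. 303] -/
theorem sectorKernel_gramCoeffList_comm (odd : Bool) (a : ℝ) (ks : List PrimeLen) (i j : ℕ) :
    sectorKernel odd (gramCoeffList a ks) i j = sectorKernel odd (gramCoeffList a ks) j i := by
  cases odd
  · simpa [sectorKernel] using evenKernel_comm (gramCoeffList_comm a ks) (gramCoeffList_neg_neg a ks) i j
  · simpa [sectorKernel] using oddKernel_comm (gramCoeffList_comm a ks) (gramCoeffList_neg_neg a ks) i j

variable {N : ℕ}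

/-- `evenBox ∋ M⁺(n,m)` for the list-form kernel. [cite: Moore1966, Ch. 3 (interval arithmetic: inclusion property)] -/
theorem mem_evenBox_list (hS : 0 < S) (ha0 : 0 < a) (hC : ConstsValid S a ks C)
    (hT : TabValid S a ks N tab) {n m : ℕ} (hn : n < N) (hm : m < N) :
    MI.mem S (evenKernel (gramCoeffList a ks) n m) (evenBox S C tab n m) := by
  unfold evenKernel evenBox
  have h0 : 0 < N := by omega
  by_cases hn0 : n = 0
  · subst hn0
    simp only [if_true]
    have := mem_gramBox_list hS ha0 hC (hT 0 h0).1 (fun _ ↦ (hT 0 h0).2) (hT m hm).1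
    simpa using this
  · simp only [hn0, if_false]
    by_cases hm0 : m = 0
    · subst hm0
      simp only [if_true]
      have := mem_gramBox_list hS ha0 hC (hT n hn).1 (fun _ ↦ (hT n hn).2) (hT 0 h0).1
      simpa using this
    · simp only [hm0, if_false]
      have h1 := mem_gramBox_list hS ha0 hC (hT n hn).1 (fun _ ↦ (hT n hn).2) (hT m hm).1
      have h2 := mem_gramBox_list hS ha0 hC (hT n hn).1
        (fun h ↦ absurd h (by omega)) (OffValid.flip (hT m hm).1)
      have := MI.mem_divNat (MI.mem_add h1 h2) (n := 2) (by norm_num)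
      exact mem_of_eq this (by push_cast; ring)

/-- `oddBox ∋ M⁻(k,l)` for the list-form kernel. [cite: Moore1966, Ch. 3 (interval arithmetic: inclusion property)] -/
theorem mem_oddBox_list (hS : 0 < S) (ha0 : 0 < a) (hC : ConstsValid S a ks C)
    (hT : TabValid S a ks N tab) {k l : ℕ} (hk : k + 1 < N) (hl : l + 1 < N) :
    MI.mem S (oddKernel (gramCoeffList a ks) k l) (oddBox S C tab k l) := by
  unfold oddKernel oddBox
  have ek : ((k + 1 : ℕ) : ℤ) = (k : ℤ) + 1 := by push_cast; ring
  have el : ((l + 1 : ℕ) : ℤ) = (l : ℤ) + 1 := by push_cast; ring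
  have hkO := (hT (k + 1) hk).1
  have hkD := (hT (k + 1) hk).2
  have hlO := (hT (l + 1) hl).1
  rw [ek] at hkO hkD
  rw [el] at hlO
  have h1 := mem_gramBox_list hS ha0 hC hkO (fun _ ↦ hkD) hlO
  have h2 := mem_gramBox_list hS ha0 hC hkO (fun h ↦ absurd h (by omega)) (OffValid.flip hlO)
  have := MI.mem_divNat (MI.mem_sub h1 h2) (n := 2) (by norm_num)
  exact mem_of_eq this (by push_cast; ring)

/-- `sectorBoxSym ∋ M^σ(i,j)` for the list-form kernel. [cite: Moore1966, Ch. 3 (interval arithmetic: inclusion property)] -/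
theorem mem_sectorBoxSym_list (hS : 0 < S) (ha0 : 0 < a) (hC : ConstsValid S a ks C)
    (hT : TabValid S a ks N tab) (odd : Bool) {i j : ℕ} (hi : i + 1 < N) (hj : j + 1 < N) :
    MI.mem S (sectorKernel odd (gramCoeffList a ks) i j) (sectorBoxSym odd S C tab i j) := by
  have hbox : ∀ {i j : ℕ}, i + 1 < N → j + 1 < N →
      MI.mem S (sectorKernel odd (gramCoeffList a ks) i j) (sectorBox odd S C tab i j) := by
    intro i j hi hj
    cases odd
    · simpa [sectorKernel, sectorBox] using mem_evenBox_list hS ha0 hC hT (by omega) (by omega)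
    · simpa [sectorKernel, sectorBox] using mem_oddBox_list hS ha0 hC hT hi hj
  unfold sectorBoxSym
  split_ifs with h
  · exact hbox hi hj
  · rw [sectorKernel_gramCoeffList_comm]; exact hbox hj hi

/-- **`checkRows` for the list-form kernel**: `|M^σ_{list}(i,j) − D_{ij}·2^{−c}| ≤ ρ·2^{−c}` on the band.
[cite: Moore1966, Ch. 3 (interval arithmetic: inclusion property)] -/
theorem near_of_checkRows_list (hS : 0 < S) (ha0 : 0 < a) (hC : ConstsValid S a ks C)
    {B : ℕ} (hT : TabValid S a ks (B + 1) tab) {c : ℕ} {ρ : ℤ} {odd : Bool} {D : List (List ℤ)} {i0 k : ℕ}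
    (h : checkRows S c ρ C tab odd B D i0 k = true) {i j : ℕ} (hi : i0 ≤ i) (hik : i < i0 + k) (hj : j < B)
    (hiB : i < B) :
    |sectorKernel odd (gramCoeffList a ks) i j - (PsdDyadic.getMZ D i j : ℝ) * (1 / 2 ^ c)| ≤ (ρ : ℝ) * (1 / 2 ^ c) := by
  unfold checkRows at h
  rw [List.all_eq_true] at h
  have h1 := h (i - i0) (List.mem_range.mpr (by omega))
  rw [List.all_eq_true] at h1
  have h2 := h1 j (List.mem_range.mpr hj)
  rw [show i0 + (i - i0) = i by omega] at h2
  exact abs_sub_le_of_enclCheck hS h2 (mem_sectorBoxSym_list hS ha0 hC hT odd (by omega) (by omega))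

/-- **`checkCols` for the list-form kernel.** [cite: Moore1966, Ch. 3 (interval arithmetic: inclusion property)] -/
theorem near_of_checkCols_list (hS : 0 < S) (ha0 : 0 < a) (hC : ConstsValid S a ks C)
    (hT : TabValid S a ks N tab) {c : ℕ} {ρ : ℤ} {odd : Bool} {B : ℕ} {Dc : List (List ℤ)} {m0 k : ℕ}
    (h : checkCols S c ρ C tab odd B Dc m0 k = true) (hBN : B + 1 ≤ N) (hkN : m0 + k + 1 ≤ N)
    {i t : ℕ} (hi : i < B) (ht : t < k) :
    |sectorKernel odd (gramCoeffList a ks) i (m0 + t) - (PsdDyadic.getMZ Dc t i : ℝ) * (1 / 2 ^ c)|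
      ≤ (ρ : ℝ) * (1 / 2 ^ c) := by
  unfold checkCols at h
  rw [List.all_eq_true] at h
  have h1 := h t (List.mem_range.mpr ht)
  rw [List.all_eq_true] at h1
  have h2 := h1 i (List.mem_range.mpr hi)
  exact abs_sub_le_of_enclCheck hS h2 (mem_sectorBoxSym_list hS ha0 hC hT odd (by omega) (by omega))

end Encl

end Literature.NumberTheory.LFunctions.Yoshida1992
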